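import Summits.NavierStokesRegularity.NavierStokesRegularity.Theses.AxisymmetricExtremality
import Summits.NavierStokesRegularity.NavierStokesRegularity.Theorems.AxisymmetricExtremalityAxisymmetricKatoGlobalStubSeregin2020TypeIILemma22ExpansionStep
import HarnessLib

/-!
# Seregin 2020, Lemma 2.2 (after Nazarov–Uraltseva 2012), piece L22-C: the chain of cylinders
# (N–U Lemma 3.4) from the three analytic atoms

Helper toward the stub `stub_seregin2020TypeII` of the crux `AxisymmetricKatoGlobal` (= the named
fact `Literature.Analysis.FluidPDE.Seregin2020_axisymmetricSingularPoint_typeII`, G. Seregin,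
Anal. Math. Phys. 10 (2020) Paper 46 = arXiv:2006.04140, Thm 2.1; missing ingredient: Lemma 2.2
= N–U Lemma 4.2 in class 𝒱, rendered `hWH′`). Piece L22-C (seat ns-in-ser-c; skeleton
`Cruxes/AxisymmetricKatoGlobal/Seregin2020Lemma22ExpansionOfPositivity.lean`) = N–U Cor 3.3
«expansion of positivity» from the analytic atoms L3.1′/L3.2′/L3.3′. The sibling
`…Lemma22ExpansionStep` proved one step (N–U Cor 3.2 (2)); this file iterates it:

* `chain_lowerBound` — N–U Lemma 3.4: along `M` cylinders of radii `(1 - m/2M)R ∈ [R/2, R]` and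
  time step `h`, from `t' = -Mh` up to `0`, a full-ball bound `Φ(t', ·) ≥ κ` on `B(R)` gives
  `Φ ≥ β̂^M κ` a.e. on `]t', 0[ × B(R/2)`, `β̂ = 2^{-(s+1)}/3`; the bound is passed to each next
  bottom slice by `ae_ball_le_of_ae_cylinder_le` (continuity off the axis set `S` replaces N–U's
  Lipschitz continuity) and the slices `{t = t_m}` are null.

The atoms enter as written-out hypotheses specialised to the data (energy-class formulation: no
Navier–Stokes object, no axis condition appears here).

## References

* A. I. Nazarov, N. N. Uraltseva, St. Petersburg Math. J. 23 (2012) 93–115 = arXiv:1011.1888,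
  §3, Lemma 3.4 and Cor 3.2. [NazarovUraltseva2012]
* G. Seregin, Anal. Math. Phys. 10 (2020), Paper 46 = arXiv:2006.04140, Lemma 2.2. [Seregin2020]
-/

-- the problem directory repeats the summit name (D-0017); core's `dupNamespace` linter fires
set_option linter.dupNamespace false

noncomputable section

open MeasureTheory Set Function Filter Topology TopologicalSpace Metric
open scoped NNReal ENNReal

namespace Summit.NavierStokesRegularity.NavierStokesRegularity.Theorems.AxisymmetricKatoGlobal.EulerScaling

open Literature.Analysis.FluidPDE Literature.Analysis.FluidPDE.Seregin2020

/-! ### The chain of cylinders (N–U Lemma 3.4) -/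

/-- **Nazarov–Uraltseva's Lemma 3.4 (chain of cylinders), from the three analytic atoms.** In the
setting of `chain_step` (atoms `h32`, `h33`, `h31` specialised to the data and to fixed constants),
with `Φ` continuous off the closed axis set `S`: let `M ≥ 1` cylinders of time step `h > 0`,
`Mh < R²`, with `λlo ≤ 1 + 1/(2M)` and `h/R² ∈ [θlo, θhi/16]`, `4h/R² ≤ θ₀`. If
`Φ(-Mh, ·) ≥ κ` a.e. on `B(R)` (`0 < κ ≤ k`), then `Φ ≥ β̂^M κ` a.e. on `]-Mh, 0[ × B(R/2)`,
`β̂ = 2^{-(s+1)}/3`: apply `chain_step` successively on the cylinders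
`]t_m, t_{m+1}[ × B(r_{m+1})`, `t_m = -(M-m)h`, `r_m = (1 - m/2M)R ∈ [R/2, R]`
(ratios `r_m/r_{m+1} ∈ [1 + 1/2M, 2]`, windows `h/r_m² ∈ [h/R², 4h/R²]`), passing the bound to
the next bottom slice by `ae_ball_le_of_ae_cylinder_le`; the slices `{t = t_m}` are null.
[cite: NazarovUraltseva2012, Lemma 3.4 and its proof] -/
theorem chain_lowerBound {Φ : ℝ → EuclideanSpace ℝ (Fin 3) → ℝ}
    {S : Set (ℝ × EuclideanSpace ℝ (Fin 3))} (hS : IsClosed S)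
    (hSax : ∀ z ∈ S, cylRadius z.2 = 0)
    (hcont : ContinuousOn (uncurry Φ) ({z : ℝ × EuclideanSpace ℝ (Fin 3) | z.1 < 0} \ S))
    {k R θ₀ μ μ₁ lamlo θlo θhi : ℝ} {s : ℕ}
    (h32 : ∀ (ρ θ t₀ κ : ℝ), R / 4 ≤ ρ → ρ ≤ 2 * R → 0 < θ → θ ≤ θ₀ →
      t₀ ≤ 0 → -R ^ 2 < t₀ - θ * ρ ^ 2 → 0 < κ → κ ≤ k →
      ENNReal.ofReal 1 * volume (ball (0 : EuclideanSpace ℝ (Fin 3)) ρ)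
        ≤ volume {x : EuclideanSpace ℝ (Fin 3) |
            x ∈ ball (0 : EuclideanSpace ℝ (Fin 3)) ρ ∧ κ ≤ Φ (t₀ - θ * ρ ^ 2) x} →
      ∀ t ∈ Icc (t₀ - θ * ρ ^ 2) t₀, t < 0 →
        ENNReal.ofReal (1 / 3) * volume (ball (0 : EuclideanSpace ℝ (Fin 3)) ρ)
          ≤ volume {x : EuclideanSpace ℝ (Fin 3) |
              x ∈ ball (0 : EuclideanSpace ℝ (Fin 3)) ρ ∧ 1 * κ / 3 ≤ Φ t x})
    (h33 : ∀ (lam ρ θ t₀ κ₀ : ℝ), 2 ≤ lam → lam ≤ 2 → R / 4 ≤ ρ → lam * ρ ≤ 2 * R →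
      θlo ≤ θ → θ ≤ θhi → t₀ ≤ 0 → -R ^ 2 < t₀ - θ * ρ ^ 2 → 0 < κ₀ → κ₀ ≤ k →
      (∀ᵐ t ∂(volume.restrict (Ioo (t₀ - θ * ρ ^ 2) t₀)),
        ENNReal.ofReal (1 / 3) * volume (ball (0 : EuclideanSpace ℝ (Fin 3)) ρ)
          ≤ volume {x : EuclideanSpace ℝ (Fin 3) |
              x ∈ ball (0 : EuclideanSpace ℝ (Fin 3)) ρ ∧ κ₀ ≤ Φ t x}) →
      volume {z : ℝ × EuclideanSpace ℝ (Fin 3) |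
          z ∈ Ioo (t₀ - θ * ρ ^ 2) t₀ ×ˢ ball (0 : EuclideanSpace ℝ (Fin 3)) ρ ∧
            Φ z.1 z.2 < (2 : ℝ)⁻¹ ^ s * κ₀}
        ≤ ENNReal.ofReal μ *
          volume (Ioo (t₀ - θ * ρ ^ 2) t₀ ×ˢ ball (0 : EuclideanSpace ℝ (Fin 3)) ρ))
    (h31 : ∀ (lam ρ θ t₀ l : ℝ), lamlo ≤ lam → lam ≤ 2 → R / 4 ≤ ρ → lam * ρ ≤ 2 * R →
      θlo ≤ θ → θ ≤ θhi → t₀ ≤ 0 → -R ^ 2 < t₀ - θ * ρ ^ 2 → 0 < l → l ≤ k →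
      volume {z : ℝ × EuclideanSpace ℝ (Fin 3) |
          z ∈ Ioo (t₀ - θ * ρ ^ 2) t₀ ×ˢ ball (0 : EuclideanSpace ℝ (Fin 3)) (lam * ρ) ∧
            Φ z.1 z.2 < l}
        ≤ ENNReal.ofReal μ₁ *
          volume (Ioo (t₀ - θ * ρ ^ 2) t₀ ×ˢ ball (0 : EuclideanSpace ℝ (Fin 3)) (lam * ρ)) →
      (∀ᵐ z ∂(volume.restrict (Ioo (t₀ - θ / 2 * ρ ^ 2) t₀ ×ˢ
          ball (0 : EuclideanSpace ℝ (Fin 3)) ρ)), l / 2 ≤ Φ z.1 z.2) ∧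
      ((∀ᵐ x ∂(volume.restrict (ball (0 : EuclideanSpace ℝ (Fin 3)) (lam * ρ))),
          l ≤ Φ (t₀ - θ * ρ ^ 2) x) →
        ∀ᵐ z ∂(volume.restrict (Ioo (t₀ - θ * ρ ^ 2) t₀ ×ˢ
          ball (0 : EuclideanSpace ℝ (Fin 3)) ρ)), l / 2 ≤ Φ z.1 z.2))
    (hμ : μ ≤ μ₁)
    {M : ℕ} (hM : 1 ≤ M) (hlamlo : lamlo ≤ 1 + 1 / (2 * M)) (hR : 0 < R)
    {h : ℝ} (hh : 0 < h) (hMh : (M : ℝ) * h < R ^ 2)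
    (hθlo : θlo ≤ h / R ^ 2) (hθhi : 16 * (h / R ^ 2) ≤ θhi) (hθ₀ : 4 * (h / R ^ 2) ≤ θ₀)
    {κ : ℝ} (hκ : 0 < κ) (hκk : κ ≤ k)
    (hslice : ∀ᵐ x ∂(volume.restrict (ball (0 : EuclideanSpace ℝ (Fin 3)) R)),
      κ ≤ Φ (-((M : ℝ) * h)) x) :
    ∀ᵐ z ∂(volume.restrict (Ioo (-((M : ℝ) * h)) 0 ×ˢ ball (0 : EuclideanSpace ℝ (Fin 3)) (R / 2))),
      ((2 : ℝ)⁻¹ ^ (s + 1) / 3) ^ M * κ ≤ Φ z.1 z.2 := by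
  -- notation: `β`, radii `rad m`, times `tm m`, windows `θm m`
  set β : ℝ := (2 : ℝ)⁻¹ ^ (s + 1) / 3 with hβ
  have hβ0 : 0 < β := by positivity
  have hβ1 : β ≤ 1 := by
    have : (2 : ℝ)⁻¹ ^ (s + 1) ≤ 1 := pow_le_one₀ (by norm_num) (by norm_num)
    rw [hβ]; linarith
  have hMr : (1 : ℝ) ≤ M := by exact_mod_cast hM
  have hM0 : (0 : ℝ) < M := by linarith
  obtain ⟨rad, hrad⟩ : ∃ rad : ℕ → ℝ, ∀ m, rad m = R * (2 * M - m) / (2 * M) := ⟨_, fun _ => rfl⟩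
  obtain ⟨tm, htm⟩ : ∃ tm : ℕ → ℝ, ∀ m, tm m = -((M : ℝ) - m) * h := ⟨_, fun _ => rfl⟩
  have hR2 : 0 < R ^ 2 := by positivity
  have hR42 : R / 4 ≤ R / 2 := by linarith
  -- elementary facts on the radii and times
  have rad_pos : ∀ m, m ≤ M → 0 < rad m := fun m hm => by
    rw [hrad]
    have : (m : ℝ) ≤ M := by exact_mod_cast hm
    apply div_pos (mul_pos hR (by linarith)) (by linarith)
  have rad_le : ∀ m, rad m ≤ R := fun m => by
    rw [hrad, div_le_iff₀ (by linarith)]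
    have : (0 : ℝ) ≤ m := Nat.cast_nonneg m
    nlinarith
  have rad_ge : ∀ m, m ≤ M → R / 2 ≤ rad m := fun m hm => by
    rw [hrad, le_div_iff₀ (by linarith)]
    have : (m : ℝ) ≤ M := by exact_mod_cast hm
    nlinarith
  have rad_zero : rad 0 = R := by rw [hrad]; field_simp; ring
  have rad_ratio : ∀ m, m < M → lamlo ≤ rad m / rad (m + 1) ∧ rad m / rad (m + 1) ≤ 2 ∧
      rad (m + 1) < rad m := fun m hm => by
    have hm' : (m : ℝ) + 1 ≤ M := by exact_mod_cast hm
    have hpos1 := rad_pos (m + 1) hm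
    have hden : (0 : ℝ) < 2 * M - m - 1 := by linarith
    have hm0 : (0 : ℝ) ≤ m := Nat.cast_nonneg m
    have hnum : (0 : ℝ) < 2 * M - m := by linarith
    have e : rad m / rad (m + 1) = (2 * M - m) / (2 * M - m - 1) := by
      rw [div_eq_div_iff hpos1.ne' hden.ne', hrad, hrad, Nat.cast_add, Nat.cast_one]
      field_simp
      ring
    refine ⟨?_, ?_, ?_⟩
    · rw [e, le_div_iff₀ hden]
      have h2 : (2 * (M : ℝ) - m - 1) / (2 * M) ≤ 1 := by
        rw [div_le_one (by linarith)]
        linarith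
      calc lamlo * (2 * M - m - 1) ≤ (1 + 1 / (2 * M)) * (2 * M - m - 1) :=
            mul_le_mul_of_nonneg_right hlamlo hden.le
        _ = (2 * M - m - 1) + (2 * M - m - 1) / (2 * M) := by ring
        _ ≤ (2 * M - m - 1) + 1 := by linarith
        _ = 2 * M - m := by ring
    · rw [e, div_le_iff₀ hden]
      linarith
    · rw [hrad, hrad, Nat.cast_add, Nat.cast_one]
      apply div_lt_div_of_pos_right _ (by linarith)
      nlinarith
  have tm_succ : ∀ m, tm m + h = tm (m + 1) := fun m => by
    rw [htm, htm, Nat.cast_add, Nat.cast_one]; ring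
  have tm_zero : tm 0 = -((M : ℝ) * h) := by rw [htm, Nat.cast_zero, sub_zero]; ring
  have tm_M : tm M = 0 := by rw [htm]; ring
  have tm_gt : ∀ m, -R ^ 2 < tm m := fun m => by
    rw [htm]
    have : (0 : ℝ) ≤ m * h := by positivity
    nlinarith
  have tm_le : ∀ m, m ≤ M → tm m ≤ 0 := fun m hm => by
    rw [htm]
    have : (m : ℝ) ≤ M := by exact_mod_cast hm
    nlinarith
  have tm_lt : ∀ m, m < M → tm m < 0 := fun m hm => by
    rw [htm]
    have : (m : ℝ) + 1 ≤ M := by exact_mod_cast hm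
    nlinarith
  have tm_mono : ∀ m, tm m < tm (m + 1) := fun m => by rw [← tm_succ]; linarith
  -- the window parameter of step `m`: `θm = h / rad m²`, so that `θm · rad m² = h`
  have θm_props : ∀ m, m ≤ M → θlo ≤ h / rad m ^ 2 ∧ 0 < h / rad m ^ 2 ∧
      h / rad m ^ 2 ≤ θ₀ ∧ 4 * (h / rad m ^ 2) ≤ θhi ∧ h / rad m ^ 2 * rad m ^ 2 = h :=
    fun m hm => by
    have hr := rad_pos m hm
    have hr2 : 0 < rad m ^ 2 := by positivity
    have hlow : h / R ^ 2 ≤ h / rad m ^ 2 := by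
      apply div_le_div_of_nonneg_left hh.le hr2
      nlinarith [rad_le m]
    have hup : h / rad m ^ 2 ≤ 4 * (h / R ^ 2) := by
      have hq : 0 < R ^ 2 / 4 := by positivity
      have h1 : h / rad m ^ 2 ≤ h / (R ^ 2 / 4) := by
        apply div_le_div_of_nonneg_left hh.le hq
        nlinarith [rad_ge m hm, hR]
      have h2 : h / (R ^ 2 / 4) = 4 * (h / R ^ 2) := by
        field_simp
      linarith
    refine ⟨hθlo.trans hlow, div_pos hh hr2, hup.trans (by linarith), by linarith,
      div_mul_cancel₀ h hr2.ne'⟩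
  -- the induction: bottom slices
  have key : ∀ m, m < M →
      ∀ᵐ x ∂(volume.restrict (ball (0 : EuclideanSpace ℝ (Fin 3)) (rad m))),
        β ^ m * κ ≤ Φ (tm m) x := by
    intro m
    induction m with
    | zero =>
      intro _
      rw [rad_zero, tm_zero, pow_zero, one_mul]
      exact hslice
    | succ m ih =>
      intro hm1
      have hm : m < M := lt_of_lt_of_le (Nat.lt_succ_self m) hm1.le
      obtain ⟨hl1, hl2, hl3⟩ := rad_ratio m hm
      obtain ⟨hθ1, hθ2, hθ3, hθ4, hθ5⟩ := θm_props m hm.le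
      have hlev0 : 0 < β ^ m * κ := by positivity
      have hlev1 : β ^ m * κ ≤ k :=
        ((mul_le_mul_of_nonneg_right (pow_le_one₀ hβ0.le hβ1) hκ.le).trans_eq (one_mul κ)).trans hκk
      have hstep := chain_step h32 h33 h31 hμ (hR42.trans (rad_ge (m + 1) hm1.le))
        (rad_pos (m + 1) hm1.le) hl3 (rad_le m) hl1 hl2 hθ1 hθ2 hθ3 hθ4 (tm_gt m)
        (by rw [hθ5, tm_succ]; exact tm_le (m + 1) hm1.le) hlev0 hlev1 (ih hm)
      rw [hθ5, tm_succ] at hstep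
      have hsl := ae_ball_le_of_ae_cylinder_le hS hSax hcont (tm_le (m + 1) hm1.le) hstep
        (tm (m + 1)) ⟨tm_mono m, le_rfl⟩ (tm_lt (m + 1) hm1)
      filter_upwards [hsl] with x hx
      calc β ^ (m + 1) * κ = β * (β ^ m * κ) := by ring
        _ = (2 : ℝ)⁻¹ ^ (s + 1) / 3 * (β ^ m * κ) := by rw [hβ]
        _ ≤ Φ (tm (m + 1)) x := hx
  -- each cylinder of the chain
  have cyl : ∀ m, m < M →
      ∀ᵐ z ∂(volume.restrict (Ioo (tm m) (tm (m + 1)) ×ˢ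
        ball (0 : EuclideanSpace ℝ (Fin 3)) (R / 2))), β ^ M * κ ≤ Φ z.1 z.2 := by
    intro m hm
    have hm1 : m + 1 ≤ M := Nat.succ_le_of_lt hm
    obtain ⟨hl1, hl2, hl3⟩ := rad_ratio m hm
    obtain ⟨hθ1, hθ2, hθ3, hθ4, hθ5⟩ := θm_props m hm.le
    have hlev0 : 0 < β ^ m * κ := by positivity
    have hlev1 : β ^ m * κ ≤ k :=
      ((mul_le_mul_of_nonneg_right (pow_le_one₀ hβ0.le hβ1) hκ.le).trans_eq (one_mul κ)).trans hκk
    have hstep := chain_step h32 h33 h31 hμ (hR42.trans (rad_ge (m + 1) hm1))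
      (rad_pos (m + 1) hm1) hl3 (rad_le m) hl1 hl2 hθ1 hθ2 hθ3 hθ4 (tm_gt m)
      (by rw [hθ5, tm_succ]; exact tm_le (m + 1) hm1) hlev0 hlev1 (key m hm)
    rw [hθ5, tm_succ] at hstep
    have hsub : Ioo (tm m) (tm (m + 1)) ×ˢ ball (0 : EuclideanSpace ℝ (Fin 3)) (R / 2) ⊆
        Ioo (tm m) (tm (m + 1)) ×ˢ ball (0 : EuclideanSpace ℝ (Fin 3)) (rad (m + 1)) :=
      Set.prod_mono Subset.rfl (ball_subset_ball (rad_ge (m + 1) hm1))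
    have hpow : β ^ M ≤ β ^ (m + 1) := pow_le_pow_of_le_one hβ0.le hβ1 hm1
    filter_upwards [ae_restrict_of_ae_restrict_of_subset hsub hstep] with z hz
    calc β ^ M * κ ≤ β ^ (m + 1) * κ := mul_le_mul_of_nonneg_right hpow hκ.le
      _ = (2 : ℝ)⁻¹ ^ (s + 1) / 3 * (β ^ m * κ) := by rw [hβ]; ring
      _ ≤ Φ z.1 z.2 := hz
  -- assembling the cylinders: the slices `{t = tm m}` are null
  have hnullT : ∀ᵐ z ∂(volume : Measure (ℝ × EuclideanSpace ℝ (Fin 3))), ∀ m : ℕ, z.1 ≠ tm m := by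
    rw [ae_all_iff]
    intro m
    have : volume ({tm m} ×ˢ (univ : Set (EuclideanSpace ℝ (Fin 3)))) = 0 := by
      rw [Measure.volume_eq_prod, Measure.prod_prod, Real.volume_singleton, zero_mul]
    refine measure_mono_null (fun z hz => ?_) this |> measure_eq_zero_iff_ae_notMem.1
    exact ⟨hz, mem_univ _⟩
  have hcylT : ∀ᵐ z ∂(volume : Measure (ℝ × EuclideanSpace ℝ (Fin 3))), ∀ m : ℕ, m < M →
      z ∈ Ioo (tm m) (tm (m + 1)) ×ˢ ball (0 : EuclideanSpace ℝ (Fin 3)) (R / 2) →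
        β ^ M * κ ≤ Φ z.1 z.2 := by
    rw [ae_all_iff]
    intro m
    by_cases hm : m < M
    · have := (ae_restrict_iff' (measurableSet_Ioo.prod measurableSet_ball)).1 (cyl m hm)
      filter_upwards [this] with z hz _ hzm
      exact hz hzm
    · exact ae_of_all _ fun z hm' => absurd hm' hm
  rw [ae_restrict_iff' (measurableSet_Ioo.prod measurableSet_ball)]
  filter_upwards [hnullT, hcylT] with z hzT hzC hz
  obtain ⟨⟨hz1, hz2⟩, hzb⟩ := hz
  -- locate the cylinder containing `z`: `m = ⌊(z.1 + Mh)/h⌋`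
  have hx0 : 0 ≤ (z.1 + M * h) / h := div_nonneg (by linarith) hh.le
  have hxM : (z.1 + M * h) / h < M := by rw [div_lt_iff₀ hh]; linarith
  obtain ⟨m, hmdef⟩ : ∃ m : ℕ, m = ⌊(z.1 + M * h) / h⌋₊ := ⟨_, rfl⟩
  have hm1 : (m : ℝ) ≤ (z.1 + M * h) / h := by rw [hmdef]; exact Nat.floor_le hx0
  have hm2 : (z.1 + M * h) / h < m + 1 := by rw [hmdef]; exact Nat.lt_floor_add_one _
  have hmM : m < M := by
    have : (m : ℝ) < M := lt_of_le_of_lt hm1 hxM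
    exact_mod_cast this
  have hm1' : (m : ℝ) * h ≤ z.1 + M * h := (le_div_iff₀ hh).1 hm1
  have hm2' : z.1 + M * h < (m + 1) * h := (div_lt_iff₀ hh).1 hm2
  refine hzC m hmM ⟨⟨?_, ?_⟩, hzb⟩
  · have hle : tm m ≤ z.1 := by rw [htm]; linarith
    exact lt_of_le_of_ne hle (Ne.symm (hzT m))
  · rw [htm, Nat.cast_add, Nat.cast_one]
    linarith

end Summit.NavierStokesRegularity.NavierStokesRegularity.Theorems.AxisymmetricKatoGlobal.EulerScaling

end
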